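import Summits.CriticalPhenomena.PercolationContinuityZ3.Theorems.PercNearOneGluingNoHeavyQuantWindowWitness
import HarnessLib

/-!
# QUANT lane R8, T-DEC: the PERTURBED LAW of the window argument — a window-DEC law moved along ≤ 2 corner segments, ≤ 2 absorber
# points and ≤ 1 leftover low; bookkeeping of the pieces and nonnegativity

builds on p205010 (kernel theorem, internal audit signed; external expert review pending)

Support file (`--supports stmt-CriticalPhenomena-4575`), QUANT lane seat prim-quant-census-2 (gen 57), rung R8 of
`run/shared/lean/prim/quant/LADDER.md`; memo `run/shared/lean/prim/quant/prim-quant-census-2-g57/WINDOW-ATOMS-G57.md` §2.3 / §4 (file H4,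
part 1).  Two bookkeeping definitions (`pertLaw`, `pertMid`), theorems with standard axioms, no sorries.  Part 2 (`…QuantWindowPerturb`)
proves that the perturbed law is `FlowAtT` at every unflipped window layer whose pool absorbs the signed change of the pieces.

* `LawDec.pertLaw x T j μ l₁ h₁ l₂ h₂ g₁ g₂ l₀ t₁ t₂ s₁ s₂ r` — `μ + t₁(e_{l₁} + c₁ e_{h₁}) + t₂(e_{l₂} + c₂ e_{h₂}) + s₁ e_{g₁} + s₂ e_{g₂} + r e_{l₀}`,
  `cᵢ = usage x T j lᵢ hᵢ` (the elementary perturbations of memo §2.3: segment bumps, absorber points, a leftover low).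
* `LawDec.pertMid x T J j M μ l₁ h₁ l₂ h₂ t₁ t₂` — the top corner run plus the two segment bumps, truncated at the column `J`.
* `LawDec.seg_of_flow_pos` — a pair carrying corner flow is an admissible (low ≤ J, mid) pair when no low mass lies in `(J, j]`.
* `LawDec.pertLaw_low` / `LawDec.pertLaw_abs` — the perturbed mass at a top-layer low / at any other position.
* **`LawDec.pertLaw_nonneg`** — the perturbed law is `≥ 0` as soon as the perturbed segment flows (H1), leftovers (H2) and residual
  capacities (H3) are.
* small sums of bumps (`sum_range_bump`, `…_gt`, `…_le`, `sum_range_usage_bump`, `sum_filter_range_ind`, `sum_Ico_ind`).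

[this work]; nothing here is cited as a published result.  The gluing rows served [cite: KozmaNitzan2024, Conjecture 3 (p. 15)]; product
measure [cite: Grimmett1999, §1.3 p. 10].
-/

noncomputable section

namespace Summit.CriticalPhenomena.PercolationContinuityZ3.Theorems

namespace Quant

open Finset

namespace LawDec

/-- indicator of equality of naturals, as a real number -/
local notation3 "𝟙[" a ", " b "]" => (if (a : ℕ) = (b : ℕ) then (1 : ℝ) else 0)

/-! ### The perturbed law and mid flow -/

/-- **the perturbed law**: `μ` moved by `t₁` along the segment `(l₁,h₁)` (rate `usage x T j l₁ h₁`), by `t₂` along `(l₂,h₂)`, by `s₁, s₂` at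
the absorbers `g₁, g₂`, by `r` at the low `l₀`. [this work] -/
def pertLaw (x T : ℝ) (j : ℕ) (μ : ℕ → ℝ) (l₁ h₁ l₂ h₂ g₁ g₂ l₀ : ℕ) (t₁ t₂ s₁ s₂ r : ℝ) : ℕ → ℝ :=
  fun b => μ b + t₁ * (𝟙[b, l₁] + usage x T j l₁ h₁ * 𝟙[b, h₁]) + t₂ * (𝟙[b, l₂] + usage x T j l₂ h₂ * 𝟙[b, h₂])
    + s₁ * 𝟙[b, g₁] + s₂ * 𝟙[b, g₂] + r * 𝟙[b, l₀]

/-- **the perturbed mid flow at layer `J`**: the top corner run plus the two segment bumps, truncated at the column `J`. [this work] -/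
def pertMid (x T : ℝ) (J j M : ℕ) (μ : ℕ → ℝ) (l₁ h₁ l₂ h₂ : ℕ) (t₁ t₂ : ℝ) : ℕ → ℕ → ℝ :=
  fun a b => if b ≤ J then cornerMidFlow x T j M μ a b + t₁ * 𝟙[a, l₁] * 𝟙[b, h₁] + t₂ * 𝟙[a, l₂] * 𝟙[b, h₂] else 0

/-! ### Small sums of bumps -/

/-- a row sum of a bump. -/
theorem sum_range_bump (M a l h : ℕ) (t : ℝ) (hh : h ≤ M) :
    ∑ b ∈ Finset.range (M + 1), t * 𝟙[a, l] * 𝟙[b, h] = t * 𝟙[a, l] :=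
  BlobDec2.sum_range_const_indicator M h hh _

/-- a row sum of a bump beyond the column `J`. -/
theorem sum_range_bump_gt (M J a l h : ℕ) (t : ℝ) (hh : h ≤ M) :
    ∑ b ∈ Finset.range (M + 1), (if J < b then t * 𝟙[a, l] * 𝟙[b, h] else 0)
      = if J < h then t * 𝟙[a, l] else 0 := by
  rw [Finset.sum_eq_single h]
  · rw [if_pos (rfl : h = h), mul_one]
  · intro b _ hne; rw [if_neg hne, mul_zero]; split_ifs <;> rfl
  · intro hnot; exact absurd (Finset.mem_range.2 (Nat.lt_succ_of_le hh)) hnot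

/-- a row sum of a bump up to the column `J`. -/
theorem sum_range_bump_le (M J a l h : ℕ) (t : ℝ) (hh : h ≤ M) :
    ∑ b ∈ Finset.range (M + 1), (if b ≤ J then t * 𝟙[a, l] * 𝟙[b, h] else 0)
      = if h ≤ J then t * 𝟙[a, l] else 0 := by
  rw [Finset.sum_eq_single h]
  · rw [if_pos (rfl : h = h), mul_one]
  · intro b _ hne; rw [if_neg hne, mul_zero]; split_ifs <;> rfl
  · intro hnot; exact absurd (Finset.mem_range.2 (Nat.lt_succ_of_le hh)) hnot

/-- a column load of a bump. -/
theorem sum_range_usage_bump (x T : ℝ) (j n l h b : ℕ) (t : ℝ) (hl : l ≤ n) :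
    ∑ a ∈ Finset.range (n + 1), usage x T j a b * (t * 𝟙[a, l] * 𝟙[b, h]) = t * usage x T j l b * 𝟙[b, h] := by
  have e : ∀ a, usage x T j a b * (t * 𝟙[a, l] * 𝟙[b, h]) = (t * 𝟙[b, h] * usage x T j a b) * 𝟙[a, l] := fun a => by ring
  simp only [e]
  rw [sum_mul_indicator_eq _ (fun a => t * 𝟙[b, h] * usage x T j a b) l (Finset.mem_range.2 (Nat.lt_succ_of_le hl))]
  ring

/-- a filtered range sum of a point mass at a member of the filter. -/
theorem sum_filter_range_ind (T : ℝ) (J l : ℕ) (c : ℝ) (hl : l ≤ J) (hlow : 2 * (l : ℝ) < T) :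
    ∑ a ∈ (Finset.range (J + 1)).filter (fun a : ℕ => 2 * (a : ℝ) < T), c * 𝟙[a, l] = c := by
  rw [Finset.sum_eq_single l]
  · rw [if_pos rfl, mul_one]
  · intro a _ hne; rw [if_neg hne, mul_zero]
  · intro hnot
    exact absurd (Finset.mem_filter.2 ⟨Finset.mem_range.2 (Nat.lt_succ_of_le hl), hlow⟩) hnot

/-- an `Ico` sum of a point mass. -/
theorem sum_Ico_ind (J M g : ℕ) (c : ℝ) :
    ∑ b ∈ Finset.Ico (J + 1) (M + 1), c * 𝟙[b, g] = if J < g ∧ g ≤ M then c else 0 := by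
  by_cases hg : J < g ∧ g ≤ M
  · rw [if_pos hg, Finset.sum_eq_single g]
    · rw [if_pos rfl, mul_one]
    · intro b _ hne; rw [if_neg hne, mul_zero]
    · intro hnot; exact absurd (Finset.mem_Ico.2 ⟨hg.1, Nat.lt_succ_of_le hg.2⟩) hnot
  · rw [if_neg hg]
    refine Finset.sum_eq_zero fun b hb => ?_
    obtain ⟨h1, h2⟩ := Finset.mem_Ico.1 hb
    rw [if_neg (fun hbg => hg ⟨by omega, by omega⟩), mul_zero]

/-! ### The pieces -/

/-- **a pair carrying corner flow is a segment**: low `l ≤ j` with `2l < T`, mid `h ≤ min(j, M)` with `T < l + h`; and `l ≤ J` as soon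
as no low mass lies in `(J, j]` (`0 < x < 1`, `μ ≥ 0`). [this work] -/
theorem seg_of_flow_pos (x T : ℝ) (J j M : ℕ) (μ : ℕ → ℝ) (hx0 : 0 < x) (hx1 : x < 1) (hμ : ∀ k, 0 ≤ μ k)
    (hgap : ∀ l, J < l → l ≤ j → 2 * (l : ℝ) < T → μ l = 0) (l h : ℕ) (hF : 0 < cornerMidFlow x T j M μ l h) :
    l ≤ j ∧ 2 * (l : ℝ) < T ∧ h ≤ M ∧ T < (l : ℝ) + h ∧ l ≤ J ∧ h ≤ j := by
  obtain ⟨h0, hsup, hrow, -⟩ := cornerFlow_inv x T j M μ hx0 hx1 hμ ((j + 1) * (j + 1)) le_rfl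
  obtain ⟨q1, q2, q3, q4, q5, -⟩ := hsup l h (ne_of_gt hF)
  refine ⟨q1, q3, q4, q5, ?_, q2⟩
  by_contra hgt; push Not at hgt
  have hm : μ l = 0 := hgap l hgt q1 q3
  have hle := hrow l
  rw [hm] at hle
  have hge := Finset.single_le_sum (f := fun h => cornerFlow x T j M μ ((j + 1) * (j + 1)) l h) (fun h _ => h0 l h)
    (Finset.mem_range.2 (Nat.lt_succ_of_le q4))
  unfold cornerMidFlow at hF
  linarith

section Pieces

variable (x T : ℝ) (j M : ℕ) (μ : ℕ → ℝ) (l₁ h₁ l₂ h₂ g₁ g₂ l₀ : ℕ) (t₁ t₂ s₁ s₂ r : ℝ)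

/-- **bumps vanish where the corner flow does** (segments carry flow). -/
theorem bumps_eq_zero_of_flow_eq_zero
    (hσ₁ : t₁ ≠ 0 → 0 < cornerMidFlow x T j M μ l₁ h₁) (hσ₂ : t₂ ≠ 0 → 0 < cornerMidFlow x T j M μ l₂ h₂)
    (a b : ℕ) (hF : cornerMidFlow x T j M μ a b = 0) :
    t₁ * 𝟙[a, l₁] * 𝟙[b, h₁] = 0 ∧ t₂ * 𝟙[a, l₂] * 𝟙[b, h₂] = 0 := by
  constructor
  · by_cases ht : t₁ = 0
    · rw [ht, zero_mul, zero_mul]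
    · by_cases hab : a = l₁ ∧ b = h₁
      · exfalso; rw [hab.1, hab.2] at hF; linarith [hσ₁ ht]
      · by_cases ha : a = l₁
        · rw [if_neg (fun hb => hab ⟨ha, hb⟩), mul_zero]
        · rw [if_neg ha, mul_zero, zero_mul]
  · by_cases ht : t₂ = 0
    · rw [ht, zero_mul, zero_mul]
    · by_cases hab : a = l₂ ∧ b = h₂
      · exfalso; rw [hab.1, hab.2] at hF; linarith [hσ₂ ht]
      · by_cases ha : a = l₂
        · rw [if_neg (fun hb => hab ⟨ha, hb⟩), mul_zero]
        · rw [if_neg ha, mul_zero, zero_mul]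

/-- **the perturbed mass at a top-layer low**: only the low parts of the pieces sit there. [this work] -/
theorem pertLaw_low (hx0 : 0 < x) (hx1 : x < 1) (hμ : ∀ k, 0 ≤ μ k)
    (hσ₁ : t₁ ≠ 0 → 0 < cornerMidFlow x T j M μ l₁ h₁) (hσ₂ : t₂ ≠ 0 → 0 < cornerMidFlow x T j M μ l₂ h₂)
    (hg₁ : s₁ ≠ 0 → g₁ ≤ M ∧ ¬ (2 * (g₁ : ℝ) < T ∧ g₁ ≤ j)) (hg₂ : s₂ ≠ 0 → g₂ ≤ M ∧ ¬ (2 * (g₂ : ℝ) < T ∧ g₂ ≤ j))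
    (a : ℕ) (ha : 2 * (a : ℝ) < T ∧ a ≤ j) :
    pertLaw x T j μ l₁ h₁ l₂ h₂ g₁ g₂ l₀ t₁ t₂ s₁ s₂ r a = μ a + t₁ * 𝟙[a, l₁] + t₂ * 𝟙[a, l₂] + r * 𝟙[a, l₀] := by
  unfold pertLaw
  have z1 : t₁ * (usage x T j l₁ h₁ * 𝟙[a, h₁]) = 0 := by
    by_cases ht : t₁ = 0
    · rw [ht, zero_mul]
    · have hne : a ≠ h₁ := by
        intro hb
        obtain ⟨-, q3, -, q5, -⟩ := seg_of_flow_pos x T j j M μ hx0 hx1 hμ (fun l h1 h2 _ => absurd h2 (not_le.2 h1)) l₁ h₁ (hσ₁ ht)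
        have e : (a : ℝ) = h₁ := by exact_mod_cast hb
        linarith [ha.1]
      rw [if_neg hne, mul_zero, mul_zero]
  have z2 : t₂ * (usage x T j l₂ h₂ * 𝟙[a, h₂]) = 0 := by
    by_cases ht : t₂ = 0
    · rw [ht, zero_mul]
    · have hne : a ≠ h₂ := by
        intro hb
        obtain ⟨-, q3, -, q5, -⟩ := seg_of_flow_pos x T j j M μ hx0 hx1 hμ (fun l h1 h2 _ => absurd h2 (not_le.2 h1)) l₂ h₂ (hσ₂ ht)
        have e : (a : ℝ) = h₂ := by exact_mod_cast hb
        linarith [ha.1]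
      rw [if_neg hne, mul_zero, mul_zero]
  have z3 : s₁ * 𝟙[a, g₁] = 0 := by
    by_cases hs : s₁ = 0
    · rw [hs, zero_mul]
    · have hne : a ≠ g₁ := by intro hb; exact (hg₁ hs).2 (by rw [← hb]; exact ha)
      rw [if_neg hne, mul_zero]
  have z4 : s₂ * 𝟙[a, g₂] = 0 := by
    by_cases hs : s₂ = 0
    · rw [hs, zero_mul]
    · have hne : a ≠ g₂ := by intro hb; exact (hg₂ hs).2 (by rw [← hb]; exact ha)
      rw [if_neg hne, mul_zero]
  rw [mul_add, mul_add, z1, z2, z3, z4]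
  ring

/-- **the perturbed mass off the top-layer lows**: only the absorber parts of the pieces sit there. [this work] -/
theorem pertLaw_abs (hx0 : 0 < x) (hx1 : x < 1) (hμ : ∀ k, 0 ≤ μ k)
    (hσ₁ : t₁ ≠ 0 → 0 < cornerMidFlow x T j M μ l₁ h₁) (hσ₂ : t₂ ≠ 0 → 0 < cornerMidFlow x T j M μ l₂ h₂)
    (hl₀ : r ≠ 0 → 2 * (l₀ : ℝ) < T ∧ l₀ ≤ j) (b : ℕ) (hb : ¬ (2 * (b : ℝ) < T ∧ b ≤ j)) :
    pertLaw x T j μ l₁ h₁ l₂ h₂ g₁ g₂ l₀ t₁ t₂ s₁ s₂ r b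
      = μ b + t₁ * (usage x T j l₁ h₁ * 𝟙[b, h₁]) + t₂ * (usage x T j l₂ h₂ * 𝟙[b, h₂]) + s₁ * 𝟙[b, g₁] + s₂ * 𝟙[b, g₂] := by
  unfold pertLaw
  have z1 : t₁ * 𝟙[b, l₁] = 0 := by
    by_cases ht : t₁ = 0
    · rw [ht, zero_mul]
    · have hne : b ≠ l₁ := by
        intro hb'
        obtain ⟨q1, q3, -⟩ := seg_of_flow_pos x T j j M μ hx0 hx1 hμ (fun l h1 h2 _ => absurd h2 (not_le.2 h1)) l₁ h₁ (hσ₁ ht)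
        exact hb (by rw [hb']; exact ⟨q3, q1⟩)
      rw [if_neg hne, mul_zero]
  have z2 : t₂ * 𝟙[b, l₂] = 0 := by
    by_cases ht : t₂ = 0
    · rw [ht, zero_mul]
    · have hne : b ≠ l₂ := by
        intro hb'
        obtain ⟨q1, q3, -⟩ := seg_of_flow_pos x T j j M μ hx0 hx1 hμ (fun l h1 h2 _ => absurd h2 (not_le.2 h1)) l₂ h₂ (hσ₂ ht)
        exact hb (by rw [hb']; exact ⟨q3, q1⟩)
      rw [if_neg hne, mul_zero]
  have z0 : r * 𝟙[b, l₀] = 0 := by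
    by_cases hr : r = 0
    · rw [hr, zero_mul]
    · have hne : b ≠ l₀ := by intro hb'; exact hb (by rw [hb']; exact hl₀ hr)
      rw [if_neg hne, mul_zero]
  rw [mul_add, mul_add, z1, z2, z0]
  ring

/-- **THE PERTURBED LAW IS NONNEGATIVE** (`μ ≥ 0`, `0 < x < 1`; segments carry flow; absorber pieces sit on top-layer absorbers, the low
piece on a top-layer low; (H1) perturbed segment flows, (H2) perturbed leftovers, (H3) perturbed residual capacities `≥ 0`). [this work] -/
theorem pertLaw_nonneg (hx0 : 0 < x) (hx1 : x < 1) (hμ : ∀ k, 0 ≤ μ k)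
    (hσ₁ : t₁ ≠ 0 → 0 < cornerMidFlow x T j M μ l₁ h₁) (hσ₂ : t₂ ≠ 0 → 0 < cornerMidFlow x T j M μ l₂ h₂)
    (hg₁ : s₁ ≠ 0 → g₁ ≤ M ∧ ¬ (2 * (g₁ : ℝ) < T ∧ g₁ ≤ j)) (hg₂ : s₂ ≠ 0 → g₂ ≤ M ∧ ¬ (2 * (g₂ : ℝ) < T ∧ g₂ ≤ j))
    (hl₀ : r ≠ 0 → 2 * (l₀ : ℝ) < T ∧ l₀ ≤ j)
    (H1 : ∀ a b, 0 ≤ cornerMidFlow x T j M μ a b + t₁ * 𝟙[a, l₁] * 𝟙[b, h₁] + t₂ * 𝟙[a, l₂] * 𝟙[b, h₂])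
    (H2 : ∀ a, 0 ≤ cornerLeftover x T j M μ a + r * 𝟙[a, l₀])
    (H3 : ∀ h, 0 ≤ μ h - ∑ a ∈ Finset.range (j + 1), usage x T j a h * cornerMidFlow x T j M μ a h
      + s₁ * 𝟙[h, g₁] + s₂ * 𝟙[h, g₂]) (b : ℕ) :
    0 ≤ pertLaw x T j μ l₁ h₁ l₂ h₂ g₁ g₂ l₀ t₁ t₂ s₁ s₂ r b := by
  obtain ⟨h0, hsup, hrow, hcol⟩ := cornerFlow_inv x T j M μ hx0 hx1 hμ ((j + 1) * (j + 1)) le_rfl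
  have hnogap : ∀ l, j < l → l ≤ j → 2 * (l : ℝ) < T → μ l = 0 := fun l h1 h2 _ => absurd h2 (not_le.2 h1)
  by_cases hlow : 2 * (b : ℝ) < T ∧ b ≤ j
  · -- a top-layer low: its mass covers its corner row (with the bumps) and its leftover (with the low piece)
    rw [pertLaw_low x T j M μ l₁ h₁ l₂ h₂ g₁ g₂ l₀ t₁ t₂ s₁ s₂ r hx0 hx1 hμ hσ₁ hσ₂ hg₁ hg₂ b hlow]
    have hrowsum : 0 ≤ ∑ h ∈ Finset.range (M + 1),
        (cornerMidFlow x T j M μ b h + t₁ * 𝟙[b, l₁] * 𝟙[h, h₁] + t₂ * 𝟙[b, l₂] * 𝟙[h, h₂]) :=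
      Finset.sum_nonneg fun h _ => H1 b h
    have e1 : ∑ h ∈ Finset.range (M + 1), t₁ * 𝟙[b, l₁] * 𝟙[h, h₁] = t₁ * 𝟙[b, l₁] := by
      by_cases ht : t₁ = 0
      · simp [ht]
      · exact sum_range_bump M b l₁ h₁ t₁ (seg_of_flow_pos x T j j M μ hx0 hx1 hμ hnogap l₁ h₁ (hσ₁ ht)).2.2.1
    have e2 : ∑ h ∈ Finset.range (M + 1), t₂ * 𝟙[b, l₂] * 𝟙[h, h₂] = t₂ * 𝟙[b, l₂] := by
      by_cases ht : t₂ = 0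
      · simp [ht]
      · exact sum_range_bump M b l₂ h₂ t₂ (seg_of_flow_pos x T j j M μ hx0 hx1 hμ hnogap l₂ h₂ (hσ₂ ht)).2.2.1
    rw [Finset.sum_add_distrib, Finset.sum_add_distrib, e1, e2] at hrowsum
    have hsplit : μ b = ∑ h ∈ Finset.range (M + 1), cornerMidFlow x T j M μ b h + cornerLeftover x T j M μ b := by
      unfold cornerLeftover; ring
    have := H2 b
    linarith
  · -- any other position: its mass covers its corner load (with the bumps) and its residual (with the absorber pieces)
    rw [pertLaw_abs x T j M μ l₁ h₁ l₂ h₂ g₁ g₂ l₀ t₁ t₂ s₁ s₂ r hx0 hx1 hμ hσ₁ hσ₂ hl₀ b hlow]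
    have hterm : ∀ a, 0 ≤ usage x T j a b *
        (cornerMidFlow x T j M μ a b + t₁ * 𝟙[a, l₁] * 𝟙[b, h₁] + t₂ * 𝟙[a, l₂] * 𝟙[b, h₂]) := by
      intro a
      by_cases hF : cornerMidFlow x T j M μ a b = 0
      · obtain ⟨q1, q2⟩ := bumps_eq_zero_of_flow_eq_zero x T j M μ l₁ h₁ l₂ h₂ t₁ t₂ hσ₁ hσ₂ a b hF
        rw [hF, q1, q2, add_zero, add_zero, mul_zero]
      · obtain ⟨-, -, q3, -, q5, -⟩ := hsup a b hF
        have hab : a < b := by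
          by_contra hge; push Not at hge
          have : (b : ℝ) ≤ a := by exact_mod_cast hge
          linarith
        exact mul_nonneg (usage_pos_of_compat x T j a b hx0 hx1 q3 hab (Or.inr q5)).le (H1 a b)
    have hcolsum : 0 ≤ ∑ a ∈ Finset.range (j + 1), usage x T j a b *
        (cornerMidFlow x T j M μ a b + t₁ * 𝟙[a, l₁] * 𝟙[b, h₁] + t₂ * 𝟙[a, l₂] * 𝟙[b, h₂]) :=
      Finset.sum_nonneg fun a _ => hterm a
    have e1 : ∑ a ∈ Finset.range (j + 1), usage x T j a b * (t₁ * 𝟙[a, l₁] * 𝟙[b, h₁])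
        = t₁ * (usage x T j l₁ h₁ * 𝟙[b, h₁]) := by
      by_cases ht : t₁ = 0
      · simp [ht]
      · rw [sum_range_usage_bump x T j j l₁ h₁ b t₁ (seg_of_flow_pos x T j j M μ hx0 hx1 hμ hnogap l₁ h₁ (hσ₁ ht)).1]
        by_cases hb : b = h₁
        · rw [hb, if_pos rfl]; ring
        · rw [if_neg hb]; ring
    have e2 : ∑ a ∈ Finset.range (j + 1), usage x T j a b * (t₂ * 𝟙[a, l₂] * 𝟙[b, h₂])
        = t₂ * (usage x T j l₂ h₂ * 𝟙[b, h₂]) := by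
      by_cases ht : t₂ = 0
      · simp [ht]
      · rw [sum_range_usage_bump x T j j l₂ h₂ b t₂ (seg_of_flow_pos x T j j M μ hx0 hx1 hμ hnogap l₂ h₂ (hσ₂ ht)).1]
        by_cases hb : b = h₂
        · rw [hb, if_pos rfl]; ring
        · rw [if_neg hb]; ring
    simp only [mul_add, Finset.sum_add_distrib] at hcolsum
    rw [e1, e2] at hcolsum
    have := H3 b
    linarith

end Pieces

end LawDec

end Quant

end Summit.CriticalPhenomena.PercolationContinuityZ3.Theorems
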